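import Mathlib.LinearAlgebra.Matrix.Rank
import Mathlib.LinearAlgebra.Dimension.Localization
import Mathlib.RingTheory.Localization.Module
import Mathlib.LinearAlgebra.FreeModule.PID
import Literature.NumberTheory.Transcendental.SixExponentialsSeveralVariablesExtremal
import Literature.Barriers.Schanuel.LinearSubgroupMethodLimitLemmas
import HarnessLib

/-!
# Waldschmidt 1981, Proposition 6.1 from Corollaire 4.2 (the algebra of §5, proved)

Topic `Literature/NumberTheory/Transcendental`; sibling proof file of
`SixExponentialsSeveralVariablesSteps.lean` (the named facts `cor_4_2`, `prop_6_1`, … of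
[Waldschmidt1981] §§3–6) and of `SixExponentialsSeveralVariablesExtremal.lean` (the extremal
subspace of Lemme 5.1). Everything here is PROVED; there are no new definitions and no new facts.
The main result is

`prop_6_1_of_cor_4_2 : cor_4_2 → prop_6_1`,

i.e. **Proposition 6.1** ("Si `d > n`, alors `μ(Y) ≤ d/(d−n)`", §6 a), p. 109) follows from the
transcendence input **Corollaire 4.2** (`χ(Y, X) ≤ n/(d−n)`, p. 105) by the algebra of the
coefficients `μ` and `χ` of §5, which this file formalises with the source's numbering:

* `lem_5_4` — **Lemme 5.4** (pp. 107–109): `K` of characteristic zero, `X`, `Y` finitely generated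
  subgroups of `Kⁿ` of ranks `d`, `ℓ`, `X' ≤ X`, `Y' ≤ Y` of ranks `r`, `s` (given by `ℤ`-bases
  `x`, `y`), `μ(X)μ(Y) ≥ μ(X) + μ(Y)` and `rang_ℤ⟨X', Y'⟩ ≤ 1` (all pairings `⟨xᵢ, yⱼ⟩` in a cyclic
  subgroup `ℤθ ⊆ K`) imply `(d − r)μ(Y) + (ℓ − s)μ(X) ≥ n μ(X)μ(Y)`. The heart is
  `exists_subspace_of_int_pairing` (the subspace `W` of p. 108, here `W = KY' ∩ (KX')^⊥`, with
  `dim W = ω − ρ` and `rang_ℤ(Y ∩ W) ≥ s − ρ`), which needs the comparison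
  `rang_ℤ N ≤ rang_K N` for integer matrices (`rank_le_rank_map_intCast`, characteristic zero)
  and rank–nullity over `ℤ`. The source's aside "on vérifie facilement que
  `dim_K(KX' ∩ KY') ≤ ρ`" (p. 109) is not used: the inequality `ω + ν − ρ ≤ n` it serves follows
  from `KY' ∩ (KX')^⊥ ⊆ (KX')^⊥`.
* `lem_5_3` — **Lemme 5.3** (p. 107): over `ℂ`, `μ(X) = d/n > 1` and `μ(Y) ≥ d/(d−n)` imply
  `χ(Y, X) ≥ (n/d) μ(Y)` (Lemme 5.4 for a pair `(X', Y')` realising `χ`; `⟨X', Y'⟩ ⊆ 2iπℤ`).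
* `exists_step`, `lem_5_2` — **Lemme 5.2** (pp. 106–107): for finitely generated `X, Y ≤ Kⁿ` there
  are `0 < n' ≤ n` and finitely generated `X', Y' ≤ K^{n'}` with `μ(X') = d'/n' ≥ d/n`,
  `μ(Y') = ℓ'/n' ≥ μ(Y)` and `⟨X', Y'⟩ ⊆ ⟨X, Y⟩` (rendered: every pairing of `X'` with `Y'` is a
  pairing of `X` with `Y`), by the printed induction on `n` — the extremal subspace `W` of
  Lemme 5.1 (`exists_extremal_subspace`), coordinates `P : W ≅ K^{n₁}` for `X ∩ W` and the
  projection `T : z ↦ (⟨z, w_k⟩)_k` for `Y` (`⟨P u, T v⟩ = ⟨u, v⟩`), together with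
  `mu_le_mu_map_of_surjective` ("`μ(Y₁, K^{n₁}) ≥ μ(Y, Kⁿ)`", p. 107).
* `prop_6_1_of_cor_4_2` — the ten-line argument of p. 109.

What remains for `prop_6_1_holds` (hence, with Lemme 5.1 and pp. 109–110, for Théorème 1.1) is
the transcendence input `cor_4_2` itself (Corollaire 3.2 = auxiliary function, Théorème 4.1 =
Masser's zero estimate, Liouville): `prop_6_1_holds := prop_6_1_of_cor_4_2 cor_4_2_holds`.

## References

* [Waldschmidt1981] M. Waldschmidt, *Transcendance et exponentielles en plusieurs variables*,
  Invent. Math. 63 (1981) 97–127, doi:10.1007/bf01389195: §5 a) definition of `μ`, Lemmes 5.1,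
  5.2 (pp. 106–107); §5 b) Lemmes 5.3, 5.4 (pp. 107–109); §6 a) Proposition 6.1 (p. 109). Read on
  the open GDZ scan PPN356556735_0063, LOG_0012.
-/

noncomputable section

open Module Submodule Matrix

namespace Literature.NumberTheory.Transcendental.Waldschmidt1981

/-! ### Generalities on `μ` -/

section MuBasics

variable {K : Type*} [Field K] {V : Type*} [AddCommGroup V] [Module K V]

/-- `μ(Γ) ≥ 0`. [folklore] -/
theorem mu_nonneg (Γ : Submodule ℤ V) : 0 ≤ mu K Γ := by
  classical
  unfold mu
  split_ifs with h
  · apply Finset.le_min'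
    intro q hq
    obtain ⟨p, hp, rfl⟩ := Finset.mem_image.mp hq
    obtain ⟨hp1, hp2, -⟩ := mem_dirichletPairs.mp hp
    unfold dirichletQuot
    apply div_nonneg
    · have : (p.2 : ℚ) ≤ Module.finrank ℤ Γ := by exact_mod_cast hp2
      linarith
    · have : (p.1 : ℚ) < Module.finrank K V := by exact_mod_cast hp1
      linarith
  · exact le_rfl

/-- `μ(Γ) ≤ ℓ/n` (the pair `W = 0`). [cite: Waldschmidt1981, §5 a) (p. 106)] -/
theorem mu_le_rank_div (Γ : Submodule ℤ V) (hn : 0 < Module.finrank K V) :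
    mu K Γ ≤ (Module.finrank ℤ Γ : ℚ) / Module.finrank K V := by
  have h := mu_le_dirichletQuot (K := K) (Γ := Γ) ⊥ (by simpa using hn)
    (by rw [rankInter_bot]; exact Nat.zero_le _)
  rw [rankInter_bot] at h
  simpa [dirichletQuot] using h

end MuBasics

/-! ### Rank–nullity over `ℤ` -/

/-- Rank–nullity for a `ℤ`-linear map on a finitely generated abelian group. [folklore] -/
theorem finrank_range_add_finrank_ker_int {M M' : Type*} [AddCommGroup M] [AddCommGroup M']
    [Module.Finite ℤ M] (f : M →ₗ[ℤ] M') :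
    Module.finrank ℤ (LinearMap.range f) + Module.finrank ℤ (LinearMap.ker f) =
      Module.finrank ℤ M := by
  rw [← f.quotKerEquivRange.finrank_eq]
  exact Submodule.finrank_quotient_add_finrank _

/-! ### `μ` does not decrease under surjective linear maps -/

section Surj

variable {K : Type*} [Field K] {V V' : Type*} [AddCommGroup V] [Module K V] [AddCommGroup V']
  [Module K V'] [FiniteDimensional K V] [FiniteDimensional K V']

omit [FiniteDimensional K V] [FiniteDimensional K V'] in
/-- For a finitely generated subgroup `Y` and a subspace `P` of `V`, the rank of `Y ∩ P` splits
along a linear map `T` with `ker T ≤ P`: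
`rang (Y ∩ P) = rang (T(Y ∩ P)) + rang (Y ∩ ker T)`. [folklore] -/
theorem finrank_inf_eq_finrank_map_add (T : V →ₗ[K] V') {Y : Submodule ℤ V} (hY : Y.FG)
    (P : Submodule K V) (hP : LinearMap.ker T ≤ P) :
    Module.finrank ℤ ↥(Y ⊓ P.restrictScalars ℤ) =
      Module.finrank ℤ ↥((Y ⊓ P.restrictScalars ℤ).map (T.restrictScalars ℤ)) +
        Module.finrank ℤ ↥(Y ⊓ (LinearMap.ker T).restrictScalars ℤ) := by
  haveI := finite_inf_of_fg hY (P.restrictScalars ℤ)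
  set Z : Submodule ℤ V := Y ⊓ P.restrictScalars ℤ
  have h := finrank_range_add_finrank_ker_int ((T.restrictScalars ℤ).domRestrict Z)
  rw [LinearMap.range_domRestrict, LinearMap.ker_domRestrict] at h
  have h2 : Module.finrank ℤ ↥(Submodule.comap Z.subtype (LinearMap.ker (T.restrictScalars ℤ))) =
      Module.finrank ℤ ↥(Y ⊓ (LinearMap.ker T).restrictScalars ℤ) := by
    rw [← Submodule.finrank_map_subtype_eq Z, Submodule.map_comap_subtype]
    have : Z ⊓ LinearMap.ker (T.restrictScalars ℤ) = Y ⊓ (LinearMap.ker T).restrictScalars ℤ := by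
      ext v
      simp only [Z, Submodule.mem_inf, Submodule.restrictScalars_mem, LinearMap.mem_ker,
        LinearMap.restrictScalars_apply]
      constructor
      · rintro ⟨⟨hv, -⟩, h0⟩; exact ⟨hv, h0⟩
      · rintro ⟨hv, h0⟩; exact ⟨⟨hv, hP h0⟩, h0⟩
    rw [this]
  omega

/-- **`μ` under a surjection.** If `T : V → V'` is `K`-linear and surjective (`dim V' > 0`) and
`Y` is a finitely generated subgroup of `V`, then `μ(Y, V) ≤ μ(T(Y), V')`: a proper subspace
`W₁` of `V'` realising `μ(T(Y))` pulls back to the proper subspace `T⁻¹(W₁)` of `V` with the same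
quotient. (Used on p. 107 of the source: "`μ(Y₁, K^{n₁}) ≥ μ(Y, Kⁿ)`".)
[cite: Waldschmidt1981, §5 a) proof of Lemme 5.2 (p. 107)] -/
theorem mu_le_mu_map_of_surjective (T : V →ₗ[K] V') (hT : Function.Surjective T)
    (hV' : 0 < Module.finrank K V') {Y : Submodule ℤ V} (hY : Y.FG) :
    mu K Y ≤ mu K (Y.map (T.restrictScalars ℤ)) := by
  set Y₁ := Y.map (T.restrictScalars ℤ) with hY₁
  obtain ⟨W₁, hW₁lt, hle₁, hmu₁⟩ := exists_mu_eq_dirichletQuot (K := K) (Γ := Y₁) hV'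
  set W := W₁.comap T with hW
  have hker : LinearMap.ker T ≤ W := by
    intro v hv
    rw [LinearMap.mem_ker] at hv
    show T v ∈ W₁
    rw [hv]; exact W₁.zero_mem
  -- dimensions over `K`
  have hdimV : Module.finrank K V = Module.finrank K V' + Module.finrank K (LinearMap.ker T) := by
    have h := LinearMap.finrank_range_add_finrank_ker T
    rw [LinearMap.range_eq_top.mpr hT, finrank_top] at h
    omega
  have hdimW : Module.finrank K W = Module.finrank K W₁ + Module.finrank K (LinearMap.ker T) := by
    have h := LinearMap.finrank_range_add_finrank_ker (T.domRestrict W)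
    rw [LinearMap.range_domRestrict, LinearMap.ker_domRestrict,
      Submodule.map_comap_eq_of_surjective hT,
      LinearEquiv.finrank_eq (Submodule.comapSubtypeEquivOfLe hker)] at h
    omega
  -- ranks over `ℤ`
  have hY₁fg : Y₁.FG := hY.map _
  have hmapW : (Y ⊓ W.restrictScalars ℤ).map (T.restrictScalars ℤ) = Y₁ ⊓ W₁.restrictScalars ℤ := by
    apply le_antisymm
    · rintro _ ⟨v, ⟨hvY, hvW⟩, rfl⟩
      exact ⟨⟨v, hvY, rfl⟩, hvW⟩
    · rintro _ ⟨⟨v, hvY, rfl⟩, hvW⟩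
      exact ⟨v, ⟨hvY, hvW⟩, rfl⟩
  have hmapTop : (Y ⊓ (⊤ : Submodule K V).restrictScalars ℤ).map (T.restrictScalars ℤ) = Y₁ := by
    rw [Submodule.restrictScalars_top, inf_top_eq]
  have h1 := finrank_inf_eq_finrank_map_add T hY W hker
  have h2 := finrank_inf_eq_finrank_map_add T hY ⊤ le_top
  rw [hmapW] at h1
  rw [hmapTop, Submodule.restrictScalars_top] at h2
  rw [inf_top_eq] at h2
  -- the pair `(dim W, rang (Y ∩ W))` is admissible and has the same quotient
  have hWlt : Module.finrank K W < Module.finrank K V := by omega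
  have hlam : rankInter K Y W ≤ Module.finrank ℤ Y := rankInter_le K hY W
  have key := mu_le_dirichletQuot (K := K) (Γ := Y) W hWlt hlam
  rw [hmu₁]
  refine key.trans (le_of_eq ?_)
  unfold dirichletQuot rankInter
  simp only
  rw [h1, h2, hdimW, hdimV]
  push_cast
  ring_nf

end Surj

/-! ### Integer matrices: rank over `ℤ` versus rank over a field of characteristic zero -/

section IntRank

variable {K : Type*} [Field K] [CharZero K] {r s : ℕ}

/-- **Base change for integer matrices.** The rank over `ℤ` of an integer matrix is at most its
rank over any field `K` of characteristic zero (independent integer columns stay independent over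
`ℚ`, hence over `K`). [folklore] -/
theorem rank_le_rank_map_intCast (N : Matrix (Fin r) (Fin s) ℤ) :
    N.rank ≤ (N.map (Int.castRingHom K)).rank := by
  classical
  set NK : Matrix (Fin r) (Fin s) K := N.map (Int.castRingHom K) with hNK
  obtain ⟨k, b⟩ := Submodule.basisOfPid (Pi.basisFun ℤ (Fin r)) (LinearMap.range N.mulVecLin)
  have hk : N.rank = k := by
    rw [Matrix.rank, Module.finrank_eq_card_basis b, Fintype.card_fin]
  -- the basis vectors, as integer vectors of `ℤ^r`, then as rational and as `K`-vectors
  set e : Fin k → Fin r → ℤ := fun t => ((b t : LinearMap.range N.mulVecLin) : Fin r → ℤ) with he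
  have heZ : LinearIndependent ℤ e :=
    b.linearIndependent.map' (LinearMap.range N.mulVecLin).subtype (Submodule.ker_subtype _)
  -- over `ℚ`
  let ιQ : (Fin r → ℤ) →ₗ[ℤ] (Fin r → ℚ) :=
    ((Int.castRingHom ℚ).compLeft (Fin r)).toAddMonoidHom.toIntLinearMap
  have hιQ : ∀ v i, ιQ v i = (v i : ℚ) := fun v i => rfl
  have hιQinj : LinearMap.ker ιQ = ⊥ := by
    rw [LinearMap.ker_eq_bot']
    intro v hv
    funext i
    have h := congrFun hv i
    rw [hιQ, Pi.zero_apply] at h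
    rw [Pi.zero_apply]
    exact_mod_cast h
  have heQZ : LinearIndependent ℤ (ιQ ∘ e) := heZ.map' ιQ hιQinj
  have heQ : LinearIndependent ℚ (ιQ ∘ e) := (LinearIndependent.iff_fractionRing ℤ ℚ).mp heQZ
  -- over `K`
  have heK : LinearIndependent K (fun t i => algebraMap ℚ K ((ιQ ∘ e) t i)) :=
    Literature.Barriers.Schanuel.Roy1995.linearIndependent_algebraMap_pi heQ
  have heK' : (fun t i => algebraMap ℚ K ((ιQ ∘ e) t i)) = fun t i => ((e t i : ℤ) : K) := by
    funext t i
    simp [hιQ]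
  rw [heK'] at heK
  -- these `K`-vectors lie in the column space of `NK`
  set S : Submodule K (Fin r → K) := span K (Set.range NK.col) with hS
  let ιK : (Fin r → ℤ) →ₗ[ℤ] (Fin r → K) :=
    ((Int.castRingHom K).compLeft (Fin r)).toAddMonoidHom.toIntLinearMap
  have hιK : ∀ v, ιK v = fun i => ((v i : ℤ) : K) := fun v => rfl
  have hcols : ιK '' Set.range N.col = Set.range NK.col := by
    ext w
    simp only [Set.mem_image, Set.mem_range, exists_exists_eq_and]
    constructor
    · rintro ⟨j, rfl⟩; exact ⟨j, by funext i; simp [hιK, hNK]⟩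
    · rintro ⟨j, rfl⟩; exact ⟨j, by funext i; simp [hιK, hNK]⟩
  have hmem : ∀ t, (fun i => ((e t i : ℤ) : K)) ∈ S := by
    intro t
    have h1 : (b t : Fin r → ℤ) ∈ span ℤ (Set.range N.col) := by
      rw [← Matrix.range_mulVecLin]; exact (b t).2
    have h2 : ιK (b t : Fin r → ℤ) ∈ (span ℤ (Set.range N.col)).map ιK := Submodule.mem_map_of_mem h1
    rw [Submodule.map_span, hcols] at h2
    have h3 := Submodule.span_le_restrictScalars ℤ K (Set.range NK.col) h2
    rw [hιK] at h3
    exact h3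
  have heS : LinearIndependent K (fun t => (⟨_, hmem t⟩ : S)) := by
    refine LinearIndependent.of_comp S.subtype ?_
    exact heK
  have hle := heS.fintype_card_le_finrank
  rw [Fintype.card_fin] at hle
  rw [hk, Matrix.rank_eq_finrank_span_cols]
  exact hle

/-- Rank–nullity for an integer matrix acting on `ℤ^s`. [folklore] -/
theorem finrank_ker_add_rank_int (N : Matrix (Fin r) (Fin s) ℤ) :
    Module.finrank ℤ (LinearMap.ker N.mulVecLin) + N.rank = s := by
  have h := finrank_range_add_finrank_ker_int N.mulVecLin
  rw [Module.finrank_fin_fun] at h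
  rw [Matrix.rank]
  omega

end IntRank

/-! ### One half of Lemme 5.4: the subspace `W` attached to a rank-one pairing -/

section Half

variable {K : Type*} [Field K] {n r s : ℕ}

/-- The linear map `v ↦ (⟨aᵢ, v⟩)ᵢ` is `(Matrix.of a).mulVecLin`. [folklore] -/
theorem of_mulVecLin_apply (a : Fin r → Fin n → K) (v : Fin n → K) (i : Fin r) :
    (Matrix.of a).mulVecLin v i = a i ⬝ᵥ v := rfl

/-- `dim ker (v ↦ (⟨aᵢ, v⟩)ᵢ) + dim span(aᵢ) = n`. [folklore] -/
theorem finrank_ker_of_mulVecLin_add (a : Fin r → Fin n → K) :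
    Module.finrank K (LinearMap.ker (Matrix.of a).mulVecLin) +
      Module.finrank K (span K (Set.range a)) = n := by
  have h1 := LinearMap.finrank_range_add_finrank_ker (Matrix.of a).mulVecLin
  rw [Module.finrank_fin_fun] at h1
  have h2 : Module.finrank K (LinearMap.range (Matrix.of a).mulVecLin) =
      Module.finrank K (span K (Set.range a)) := by
    rw [← Matrix.rank, Matrix.rank_eq_finrank_span_row]
    rfl
  omega

/-- `(∑ₖ cₖ • wₖ) ⬝ᵥ v = ∑ₖ cₖ (wₖ ⬝ᵥ v)`. [folklore] -/
theorem sum_smul_dotProduct {ι : Type*} [Fintype ι] {R : Type*} [CommSemiring R] (c : ι → R)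
    (w : ι → Fin n → R) (v : Fin n → R) :
    (∑ k, c k • w k) ⬝ᵥ v = ∑ k, c k * (w k ⬝ᵥ v) := by
  unfold dotProduct
  simp only [Finset.sum_apply, Pi.smul_apply, smul_eq_mul, Finset.sum_mul, Finset.mul_sum]
  rw [Finset.sum_comm]
  exact Finset.sum_congr rfl fun k _ => Finset.sum_congr rfl fun i _ => by ring

variable [CharZero K]

/-- **Half of Lemme 5.4** (the subspace `W` of p. 108). Let `a₁, …, a_r ∈ Kⁿ`, not all zero, let
`y₁, …, y_s` be `ℤ`-linearly independent elements of a finitely generated subgroup `Y` of `Kⁿ`,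
and suppose the pairings are integers: `⟨aᵢ, yⱼ⟩ = N i j ∈ ℤ`. Let `ρ` be the rank (over `K`)
of `N` and `ω = dim_K (K y₁ + … + K y_s)`. Then the subspace
`W = (K y₁ + … + K y_s) ∩ {v ; ⟨aᵢ, v⟩ = 0 ∀ i}` is proper, orthogonal to the `aᵢ`, of dimension
`ω − ρ`, and `rang_ℤ (Y ∩ W) ≥ s − ρ` (it contains the `∑ mⱼ yⱼ` for the integer vectors `m` of
the kernel of `N`, a group of rank `s − rang_ℤ N ≥ s − ρ`).
[cite: Waldschmidt1981, §5 b) proof of Lemme 5.4 (p. 108)] -/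
theorem exists_subspace_of_int_pairing (a : Fin r → Fin n → K) (ha : ∃ i, a i ≠ 0)
    {Y : Submodule ℤ (Fin n → K)} (hY : Y.FG) (y : Fin s → Fin n → K)
    (hy : LinearIndependent ℤ y) (hyY : ∀ j, y j ∈ Y) (N : Matrix (Fin r) (Fin s) ℤ)
    (hN : ∀ i j, a i ⬝ᵥ y j = ((N i j : ℤ) : K)) :
    ∃ W : Submodule K (Fin n → K), W ≤ LinearMap.ker (Matrix.of a).mulVecLin ∧
      Module.finrank K W < n ∧
      Module.finrank K W + (N.map (Int.castRingHom K)).rank =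
        Module.finrank K (span K (Set.range y)) ∧
      s ≤ rankInter K Y W + (N.map (Int.castRingHom K)).rank := by
  classical
  set Φ := (Matrix.of a).mulVecLin with hΦ
  set U : Submodule K (Fin n → K) := span K (Set.range y) with hU
  set NK : Matrix (Fin r) (Fin s) K := N.map (Int.castRingHom K) with hNK
  have hΦy : ∀ j, Φ (y j) = NK.col j := by
    intro j; funext i
    rw [of_mulVecLin_apply, hN i j]
    simp [hNK]
  refine ⟨U ⊓ LinearMap.ker Φ, inf_le_right, ?_, ?_, ?_⟩
  · -- proper: `⟨a_{i₀}, e_k⟩ ≠ 0` for a coordinate `k` with `a_{i₀} k ≠ 0`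
    obtain ⟨i₀, hi₀⟩ := ha
    obtain ⟨k, hk⟩ : ∃ k, a i₀ k ≠ 0 := by
      by_contra h
      push Not at h
      exact hi₀ (funext h)
    have hne : U ⊓ LinearMap.ker Φ ≠ ⊤ := by
      intro htop
      have hmem : (Pi.single k 1 : Fin n → K) ∈ U ⊓ LinearMap.ker Φ := htop ▸ Submodule.mem_top
      have h0 := congrFun (LinearMap.mem_ker.mp hmem.2) i₀
      rw [of_mulVecLin_apply, dotProduct_single, mul_one] at h0
      exact hk h0
    have := Submodule.finrank_lt hne
    rwa [Module.finrank_fin_fun] at this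
  · -- dimension `ω − ρ`: rank–nullity for `Φ` restricted to `U`
    have h1 := LinearMap.finrank_range_add_finrank_ker (Φ.domRestrict U)
    rw [LinearMap.range_domRestrict, LinearMap.ker_domRestrict] at h1
    have h2 : Module.finrank K (Submodule.comap U.subtype (LinearMap.ker Φ)) =
        Module.finrank K ↥(U ⊓ LinearMap.ker Φ) := by
      rw [← Submodule.finrank_map_subtype_eq U, Submodule.map_comap_subtype]
    have h3 : Submodule.map Φ U = span K (Set.range NK.col) := by
      rw [hU, Submodule.map_span, ← Set.range_comp, show (⇑Φ ∘ y) = NK.col from funext hΦy]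
    have h4 : Module.finrank K (Submodule.map Φ U) = NK.rank := by
      rw [h3, Matrix.rank_eq_finrank_span_cols]
    omega
  · -- the integer kernel of `N` injects into `Y ∩ W`
    set L : Submodule ℤ (Fin s → ℤ) := LinearMap.ker N.mulVecLin with hL
    have hL1 : Module.finrank ℤ L + N.rank = s := finrank_ker_add_rank_int N
    have hL2 : N.rank ≤ NK.rank := rank_le_rank_map_intCast N
    -- `ψ m = ∑ mⱼ yⱼ`
    set ψ : (Fin s → ℤ) →ₗ[ℤ] (Fin n → K) := Fintype.linearCombination ℤ y with hψ
    have hψinj : Function.Injective ψ := by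
      rw [← LinearMap.ker_eq_bot, LinearMap.ker_eq_bot']
      intro m hm
      rw [hψ, Fintype.linearCombination_apply] at hm
      funext j
      exact Fintype.linearIndependent_iff.mp hy m hm j
    have hψL : L.map ψ ≤ Y ⊓ (U ⊓ LinearMap.ker Φ).restrictScalars ℤ := by
      rintro _ ⟨m, hm, rfl⟩
      rw [hψ, Fintype.linearCombination_apply]
      refine ⟨Submodule.sum_mem _ fun j _ => Submodule.smul_mem _ _ (hyY j), ?_, ?_⟩
      · show (∑ j, m j • y j) ∈ U
        refine Submodule.sum_mem _ fun j _ => ?_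
        rw [← Int.cast_smul_eq_zsmul K]
        exact Submodule.smul_mem _ _ (Submodule.subset_span ⟨j, rfl⟩)
      · show (∑ j, m j • y j) ∈ LinearMap.ker Φ
        have hm' : N *ᵥ m = 0 := by
          have := LinearMap.mem_ker.mp hm
          rwa [Matrix.mulVecLin_apply] at this
        rw [LinearMap.mem_ker, map_sum]
        simp only [map_zsmul, hΦy]
        funext i
        have hi := congrFun hm' i
        rw [Pi.zero_apply] at hi
        change (∑ j, N i j * m j) = 0 at hi
        rw [Finset.sum_apply, Pi.zero_apply]
        simp only [Pi.smul_apply, zsmul_eq_mul]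
        have : (∑ j, (m j : K) * NK.col j i) = ((∑ j, N i j * m j : ℤ) : K) := by
          push_cast
          refine Finset.sum_congr rfl fun j _ => ?_
          rw [mul_comm]
          rfl
        rw [this, hi, Int.cast_zero]
    haveI := finite_inf_of_fg hY ((U ⊓ LinearMap.ker Φ).restrictScalars ℤ)
    have h5 : Module.finrank ℤ L ≤ rankInter K Y (U ⊓ LinearMap.ker Φ) := by
      rw [rankInter, LinearEquiv.finrank_eq (Submodule.equivMapOfInjective ψ hψinj L)]
      exact Submodule.finrank_mono hψL
    omega

/-- **The bound on `μ` from a rank-one pairing** (p. 108: "`μ(Y) ≤ (ℓ − s + ρ)/(n − ω + ρ)`"),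
in cross-multiplied form together with the dimension count `ω − ρ ≤ n − ν`: under the
hypotheses of `exists_subspace_of_int_pairing` there are natural numbers `w` (`= dim W`) and
`λ` (`= rang_ℤ (Y ∩ W)`) with `μ(Y) ≤ (ℓ − λ)/(n − w)`, `w + ρ = ω`, `s ≤ λ + ρ`,
`w + ν ≤ n`, `w < n`, `λ ≤ ℓ`. [cite: Waldschmidt1981, §5 b) proof of Lemme 5.4 (p. 108)] -/
theorem mu_le_of_int_pairing (a : Fin r → Fin n → K) (ha : ∃ i, a i ≠ 0)
    {Y : Submodule ℤ (Fin n → K)} (hY : Y.FG) (y : Fin s → Fin n → K)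
    (hy : LinearIndependent ℤ y) (hyY : ∀ j, y j ∈ Y) (N : Matrix (Fin r) (Fin s) ℤ)
    (hN : ∀ i j, a i ⬝ᵥ y j = ((N i j : ℤ) : K)) :
    ∃ w lam : ℕ, w < n ∧ lam ≤ Module.finrank ℤ Y ∧
      w + (N.map (Int.castRingHom K)).rank = Module.finrank K (span K (Set.range y)) ∧
      s ≤ lam + (N.map (Int.castRingHom K)).rank ∧
      w + Module.finrank K (span K (Set.range a)) ≤ n ∧
      mu K Y ≤ ((Module.finrank ℤ Y : ℚ) - lam) / ((n : ℚ) - w) := by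
  obtain ⟨W, hWker, hWlt, hWdim, hWrank⟩ := exists_subspace_of_int_pairing a ha hY y hy hyY N hN
  have hlam : rankInter K Y W ≤ Module.finrank ℤ Y := rankInter_le K hY W
  refine ⟨Module.finrank K W, rankInter K Y W, hWlt, hlam, hWdim, hWrank, ?_, ?_⟩
  · have h := finrank_ker_of_mulVecLin_add a
    have := Submodule.finrank_mono hWker
    omega
  · have h := mu_le_dirichletQuot (K := K) (Γ := Y) W (by rwa [Module.finrank_fin_fun]) hlam
    simpa [dirichletQuot] using h

end Half

/-! ### Bases of finitely generated subgroups of `Kⁿ` -/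

section Bases

variable {K : Type*} [Field K] {n : ℕ}

/-- A subgroup of a finitely generated subgroup of `Kⁿ` is finitely generated (as a `ℤ`-module).
[folklore] -/
theorem finite_of_le_fg {Z Z' : Submodule ℤ (Fin n → K)} (hZ : Z.FG) (h : Z' ≤ Z) :
    Module.Finite ℤ Z' := by
  haveI : Module.Finite ℤ Z := Module.Finite.iff_fg.mpr hZ
  exact Module.Finite.of_injective (Submodule.inclusion h) (Submodule.inclusion_injective h)

/-- `ℤ`-linearly independent elements of a finitely generated subgroup `Z`: at most `rang_ℤ Z` of
them. [folklore] -/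
theorem card_le_finrank_of_mem {s : ℕ} {Z : Submodule ℤ (Fin n → K)} (hZ : Z.FG)
    {z : Fin s → Fin n → K} (hz : LinearIndependent ℤ z) (hzZ : ∀ j, z j ∈ Z) :
    s ≤ Module.finrank ℤ Z := by
  haveI : Module.Finite ℤ Z := Module.Finite.iff_fg.mpr hZ
  have h : LinearIndependent ℤ (fun j => (⟨z j, hzZ j⟩ : Z)) :=
    LinearIndependent.of_comp Z.subtype (by exact hz)
  simpa using h.fintype_card_le_finrank

/-- Scaling a family by a unit does not change its span. [folklore] -/
theorem span_range_smul_eq {r : ℕ} (x : Fin r → Fin n → K) {c : K} (hc : c ≠ 0) :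
    span K (Set.range fun i => c • x i) = span K (Set.range x) := by
  apply le_antisymm
  · rw [Submodule.span_le]
    rintro _ ⟨i, rfl⟩
    exact Submodule.smul_mem _ _ (Submodule.subset_span ⟨i, rfl⟩)
  · rw [Submodule.span_le]
    rintro _ ⟨i, rfl⟩
    have : x i = c⁻¹ • (c • x i) := by rw [smul_smul, inv_mul_cancel₀ hc, one_smul]
    rw [this]
    exact Submodule.smul_mem _ _ (Submodule.subset_span ⟨i, rfl⟩)

variable [CharZero K]

/-- A finitely generated subgroup `Z` of `Kⁿ` (`char K = 0`) is free: it is `ℤz₁ ⊕ … ⊕ ℤz_d` for a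
`ℤ`-linearly independent family `z` with `d = rang_ℤ Z`. [folklore] -/
theorem exists_linearIndependent_span_eq {Z : Submodule ℤ (Fin n → K)} (hZ : Z.FG) :
    ∃ z : Fin (Module.finrank ℤ Z) → Fin n → K,
      LinearIndependent ℤ z ∧ (∀ i, z i ∈ Z) ∧ span ℤ (Set.range z) = Z := by
  haveI : Module.Finite ℤ Z := Module.Finite.iff_fg.mpr hZ
  haveI : IsAddTorsionFree (Fin n → K) := inferInstance
  haveI : IsAddTorsionFree Z :=
    Function.Injective.isAddTorsionFree Z.subtype.toAddMonoidHom Subtype.val_injective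
  haveI : Module.Free ℤ Z := Module.free_of_finite_type_torsion_free'
  let b := Module.finBasis ℤ Z
  refine ⟨fun i => (b i : Fin n → K), b.linearIndependent.map' Z.subtype (Submodule.ker_subtype _),
    fun i => (b i).2, span_range_coe_basis b⟩

end Bases

/-! ### Lemme 5.4 and Lemme 5.3 -/

section Lemma54

variable {K : Type*} [Field K] [CharZero K] {n : ℕ}

/-- **Lemme 5.4.** Let `K` be a field of characteristic zero, `X`, `Y` finitely generated
subgroups of `Kⁿ` of ranks `d`, `ℓ`, `X' = ℤx₁ ⊕ … ⊕ ℤx_r ≤ X` a subgroup of rank `r` and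
`Y' = ℤy₁ ⊕ … ⊕ ℤy_s ≤ Y` a subgroup of rank `s` (given by `ℤ`-linearly independent families).
Suppose `μ(X) μ(Y) ≥ μ(X) + μ(Y)` and `rang_ℤ ⟨X', Y'⟩ ≤ 1`, i.e. all the pairings `⟨xᵢ, yⱼ⟩` lie
in a cyclic subgroup `ℤθ` of `K`. Then `(d − r) μ(Y) + (ℓ − s) μ(X) ≥ n μ(X) μ(Y)`.
(The source's "on vérifie facilement que `dim_K(KX' ∩ KY') ≤ ρ`" is bypassed: the inequality
`ω + ν − ρ ≤ n` it serves follows from `KY' ∩ (KX')^⊥ ⊆ (KX')^⊥`.)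
[cite: Waldschmidt1981, §5 b) Lemme 5.4 (pp. 107–109)] -/
theorem lem_5_4 {X Y : Submodule ℤ (Fin n → K)} (hX : X.FG) (hY : Y.FG) {r s : ℕ}
    (x : Fin r → Fin n → K) (hx : LinearIndependent ℤ x) (hxX : ∀ i, x i ∈ X)
    (y : Fin s → Fin n → K) (hy : LinearIndependent ℤ y) (hyY : ∀ j, y j ∈ Y)
    (hμ : mu K X + mu K Y ≤ mu K X * mu K Y)
    (hpair : ∃ θ : K, ∀ i j, ∃ k : ℤ, x i ⬝ᵥ y j = k • θ) :
    (n : ℚ) * mu K X * mu K Y ≤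
      ((Module.finrank ℤ X : ℚ) - r) * mu K Y + ((Module.finrank ℤ Y : ℚ) - s) * mu K X := by
  set A := mu K X with hA
  set B := mu K Y with hB
  set d := Module.finrank ℤ X with hd
  set l := Module.finrank ℤ Y with hl
  have hA0 : 0 ≤ A := mu_nonneg X
  have hB0 : 0 ≤ B := mu_nonneg Y
  have hAB0 : 0 ≤ A * B := mul_nonneg hA0 hB0
  have hrd : r ≤ d := card_le_finrank_of_mem hX hx hxX
  have hsl : s ≤ l := card_le_finrank_of_mem hY hy hyY
  have hrd' : (r : ℚ) ≤ d := by exact_mod_cast hrd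
  have hsl' : (s : ℚ) ≤ l := by exact_mod_cast hsl
  -- the degenerate cases `n = 0`, `r = 0`, `s = 0`
  rcases Nat.eq_zero_or_pos n with hn | hn
  · subst hn
    simp only [Nat.cast_zero, zero_mul]
    nlinarith
  have hnA : (n : ℚ) * A ≤ d := by
    have h := mu_le_rank_div (K := K) X (by rwa [Module.finrank_fin_fun])
    rw [Module.finrank_fin_fun] at h
    rwa [le_div_iff₀ (by exact_mod_cast hn), mul_comm] at h
  have hnB : (n : ℚ) * B ≤ l := by
    have h := mu_le_rank_div (K := K) Y (by rwa [Module.finrank_fin_fun])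
    rw [Module.finrank_fin_fun] at h
    rwa [le_div_iff₀ (by exact_mod_cast hn), mul_comm] at h
  rcases Nat.eq_zero_or_pos r with hr | hr
  · subst hr
    simp only [Nat.cast_zero, sub_zero]
    nlinarith [mul_le_mul_of_nonneg_right hnA hB0, mul_nonneg (sub_nonneg.mpr hsl') hA0]
  rcases Nat.eq_zero_or_pos s with hs | hs
  · subst hs
    simp only [Nat.cast_zero, sub_zero]
    nlinarith [mul_le_mul_of_nonneg_right hnB hA0, mul_nonneg (sub_nonneg.mpr hrd') hB0]
  -- the pairing matrix: `⟨xᵢ, yⱼ⟩ = θ N i j`, with `θ ≠ 0` (if all pairings vanish, `θ = 1`, `N = 0`)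
  obtain ⟨θ, N, hθ, hN⟩ : ∃ (θ : K) (N : Matrix (Fin r) (Fin s) ℤ), θ ≠ 0 ∧
      ∀ i j, x i ⬝ᵥ y j = θ * ((N i j : ℤ) : K) := by
    obtain ⟨θ, hθ⟩ := hpair
    choose k hk using hθ
    by_cases h0 : θ = 0
    · refine ⟨1, 0, one_ne_zero, fun i j => ?_⟩
      rw [hk i j, h0]; simp
    · refine ⟨θ, Matrix.of k, h0, fun i j => ?_⟩
      rw [hk i j, Matrix.of_apply, zsmul_eq_mul, mul_comm]
  -- `Y`-side: the family `a = θ⁻¹ x` pairs integrally with `y`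
  set a : Fin r → Fin n → K := fun i => θ⁻¹ • x i with ha_def
  have ha : ∃ i, a i ≠ 0 :=
    ⟨⟨0, hr⟩, smul_ne_zero (inv_ne_zero hθ) (hx.ne_zero _)⟩
  have haN : ∀ i j, a i ⬝ᵥ y j = ((N i j : ℤ) : K) := by
    intro i j
    rw [ha_def]
    simp only [smul_dotProduct, hN i j, smul_eq_mul]
    rw [← mul_assoc, inv_mul_cancel₀ hθ, one_mul]
  obtain ⟨wY, lamY, hwY, hlamY, hωY, hsY, hνY, hBY⟩ := mu_le_of_int_pairing a ha hY y hy hyY N haN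
  -- `X`-side: the family `a' = θ⁻¹ y` pairs integrally with `x`, matrix `Nᵀ`
  set a' : Fin s → Fin n → K := fun j => θ⁻¹ • y j with ha'_def
  have ha' : ∃ j, a' j ≠ 0 :=
    ⟨⟨0, hs⟩, smul_ne_zero (inv_ne_zero hθ) (hy.ne_zero _)⟩
  have ha'N : ∀ j i, a' j ⬝ᵥ x i = ((N.transpose j i : ℤ) : K) := by
    intro j i
    rw [ha'_def, Matrix.transpose_apply]
    simp only [smul_dotProduct, smul_eq_mul]
    rw [dotProduct_comm, hN i j, ← mul_assoc, inv_mul_cancel₀ hθ, one_mul]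
  obtain ⟨wX, lamX, hwX, hlamX, hωX, hsX, -, hAX⟩ :=
    mu_le_of_int_pairing a' ha' hX x hx hxX N.transpose ha'N
  -- bookkeeping: same `ρ`, and `span a = span x`
  have hρ : (N.transpose.map (Int.castRingHom K)).rank = (N.map (Int.castRingHom K)).rank := by
    rw [Matrix.transpose_map, Matrix.rank_transpose]
  rw [hρ] at hωX hsX
  have hspan : span K (Set.range a) = span K (Set.range x) :=
    span_range_smul_eq x (inv_ne_zero hθ)
  rw [hspan] at hνY
  set ρ := (N.map (Int.castRingHom K)).rank with hρdef
  set ν := Module.finrank K (span K (Set.range x)) with hνdef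
  set ω := Module.finrank K (span K (Set.range y)) with hωdef
  -- the numerics
  have hnwY : (0 : ℚ) < n - wY := by
    have : (wY : ℚ) < n := by exact_mod_cast hwY
    linarith
  have hnwX : (0 : ℚ) < n - wX := by
    have : (wX : ℚ) < n := by exact_mod_cast hwX
    linarith
  rw [le_div_iff₀ hnwY] at hBY
  rw [le_div_iff₀ hnwX] at hAX
  have e1 : (wY : ℚ) + ρ = ω := by exact_mod_cast hωY
  have e2 : (s : ℚ) ≤ lamY + ρ := by exact_mod_cast hsY
  have e3 : (wY : ℚ) + ν ≤ n := by exact_mod_cast hνY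
  have e4 : (wX : ℚ) + ρ = ν := by exact_mod_cast hωX
  have e5 : (r : ℚ) ≤ lamX + ρ := by exact_mod_cast hsX
  have p1 := mul_le_mul_of_nonneg_right hBY hA0
  have p2 := mul_le_mul_of_nonneg_right hAX hB0
  have p3 := mul_le_mul_of_nonneg_right e2 hA0
  have p4 := mul_le_mul_of_nonneg_right e5 hB0
  have p5 : (ρ : ℚ) * (A + B) ≤ ρ * (A * B) := mul_le_mul_of_nonneg_left hμ (Nat.cast_nonneg ρ)
  have p6 : (n : ℚ) * (A * B) ≤ (2 * n - wY - wX - ρ) * (A * B) :=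
    mul_le_mul_of_nonneg_right (by linarith) hAB0
  nlinarith [p1, p2, p3, p4, p5, p6]

end Lemma54

section Lemma53

open Complex

/-- `χ(Y, X) ≥ 0`. [folklore] -/
theorem chi_nonneg {n : ℕ} (X Y : Submodule ℤ (Fin n → ℂ)) : 0 ≤ chi X Y := by
  classical
  unfold chi
  split_ifs with h
  · apply Finset.le_min'
    intro q hq
    obtain ⟨p, hp, rfl⟩ := Finset.mem_image.mp hq
    obtain ⟨-, hp2, -⟩ := mem_masserPairs.mp hp
    unfold masserQuot
    apply div_nonneg
    · have : (p.2 : ℚ) ≤ Module.finrank ℤ Y := by exact_mod_cast hp2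
      linarith
    · exact Nat.cast_nonneg _
  · exact le_rfl

/-- **Lemme 5.3.** Let `X`, `Y` be finitely generated subgroups of `ℂⁿ` of ranks `d`, `ℓ` with
`μ(X) = d/n > 1` and `μ(Y) ≥ d/(d − n)`. Then `χ(Y, X) ≥ (n/d) μ(Y)`. (From Lemme 5.4 applied to
an admissible pair `(X', Y')` realising `χ(Y, X)`: `⟨X', Y'⟩ ⊆ 2iπℤ` is a rank-one pairing.)
[cite: Waldschmidt1981, §5 b) Lemme 5.3 (p. 107)] -/
theorem lem_5_3 {n : ℕ} {X Y : Submodule ℤ (Fin n → ℂ)} (hX : X.FG) (hY : Y.FG)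
    (hμX : mu ℂ X = (Module.finrank ℤ X : ℚ) / n) (h1 : (n : ℚ) < Module.finrank ℤ X)
    (hμY : (Module.finrank ℤ X : ℚ) / ((Module.finrank ℤ X : ℚ) - n) ≤ mu ℂ Y) :
    (n : ℚ) / Module.finrank ℤ X * mu ℂ Y ≤ chi X Y := by
  have hB0 : 0 ≤ mu ℂ Y := mu_nonneg Y
  have hd0 : (0 : ℚ) < Module.finrank ℤ X := lt_of_le_of_lt (Nat.cast_nonneg n) h1
  -- `n = 0` is degenerate (`n/d = 0`)
  rcases Nat.eq_zero_or_pos n with hn | hn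
  · subst hn
    simp only [Nat.cast_zero, zero_div, zero_mul]
    exact chi_nonneg X Y
  have hn' : (0 : ℚ) < n := by exact_mod_cast hn
  -- `X ≠ 0`
  have hXne : X ≠ ⊥ := by
    intro h
    rw [h, finrank_bot, Nat.cast_zero] at hd0
    exact lt_irrefl _ hd0
  obtain ⟨X', Y', hX'X, hY'Y, hne, hpair, -, -, hchi⟩ := exists_chi_eq_masserQuot (Y := Y) hXne
  -- bases of `X'`, `Y'`
  haveI := finite_of_le_fg hX hX'X
  haveI := finite_of_le_fg hY hY'Y
  have hX'fg : X'.FG := Module.Finite.iff_fg.mp inferInstance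
  have hY'fg : Y'.FG := Module.Finite.iff_fg.mp inferInstance
  obtain ⟨x, hx, hxX', hxspan⟩ := exists_linearIndependent_span_eq hX'fg
  obtain ⟨y, hy, hyY', -⟩ := exists_linearIndependent_span_eq hY'fg
  -- `rang X' ≥ 1`
  have hr0 : 0 < Module.finrank ℤ X' := by
    by_contra h0
    push Not at h0
    apply hne
    rw [← hxspan, Submodule.span_eq_bot]
    rintro _ ⟨i, rfl⟩
    exact absurd i.isLt (by omega)
  -- Lemme 5.4 for the pair `(X', Y')`
  have hμ : mu ℂ X + mu ℂ Y ≤ mu ℂ X * mu ℂ Y := by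
    have hdn : (0 : ℚ) < Module.finrank ℤ X - n := by linarith
    have h2 := (div_le_iff₀ hdn).mp hμY
    rw [hμX, div_add' _ _ _ hn'.ne', div_mul_eq_mul_div, div_le_div_iff_of_pos_right hn']
    nlinarith
  have hpair' : ∃ θ : ℂ, ∀ i j, ∃ k : ℤ, x i ⬝ᵥ y j = k • θ := by
    refine ⟨2 * Real.pi * I, fun i j => ?_⟩
    obtain ⟨k, hk⟩ := hpair (x i) (hxX' i) (y j) (hyY' j)
    exact ⟨k, by rw [hk, zsmul_eq_mul, mul_comm]⟩
  have h54 := lem_5_4 hX hY x hx (fun i => hX'X (hxX' i)) y hy (fun j => hY'Y (hyY' j)) hμ hpair'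
  -- `χ(Y, X) = (ℓ − s)/r`
  rw [hchi]
  unfold masserQuot
  simp only
  have hr' : (0 : ℚ) < Module.finrank ℤ X' := by exact_mod_cast hr0
  rw [div_mul_eq_mul_div, div_le_div_iff₀ hd0 hr']
  rw [hμX] at h54
  -- abbreviations, then the arithmetic: `n A B ≤ (d − r) B + (ℓ − s) A` with `A = d/n`
  set d : ℚ := (Module.finrank ℤ X : ℚ) with hd
  set l : ℚ := (Module.finrank ℤ Y : ℚ) with hl
  set r : ℚ := (Module.finrank ℤ X' : ℚ) with hr
  set s : ℚ := (Module.finrank ℤ Y' : ℚ) with hs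
  set B := mu ℂ Y with hB
  set m : ℚ := (n : ℚ) with hm
  have e1 : m * (d / m) * B = d * B := by field_simp
  rw [e1] at h54
  have h54' := mul_le_mul_of_nonneg_right h54 hn'.le
  have e2 : ((d - r) * B + (l - s) * (d / m)) * m = (d - r) * B * m + (l - s) * d := by
    field_simp
  rw [e2] at h54'
  nlinarith [mul_nonneg hB0 hn'.le, h54']

end Lemma53

/-! ### Lemme 5.2: reduction to equidistributed subgroups -/

section Lemma52

variable {K : Type*} [Field K] {n : ℕ}

/-- **The inductive step of Lemme 5.2** (pp. 106–107). If `μ(Γ) < ℓ/n` for a finitely generated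
subgroup `Γ` of `Kⁿ` of rank `ℓ`, let `W` be the extremal subspace of Lemme 5.1 (`dim W = n₁`,
`0 < n₁ < n`), identify `W` with `K^{n₁}` by a basis `(w_k)` (coordinate map `P`), and let
`T : Kⁿ → K^{n₁}`, `z ↦ (⟨z, w_k⟩)_k` be the projection of p. 107. Then `T` is surjective,
`⟨P u, T v⟩ = ⟨u, v⟩` for `u ∈ W`, and `Γ₁ = P(Γ ∩ W)` satisfies `μ(Γ₁, K^{n₁}) = ℓ₁/n₁ > ℓ/n`.
[cite: Waldschmidt1981, §5 a) Lemme 5.1 and proof of Lemme 5.2 (pp. 106–107)] -/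
theorem exists_step {Γ : Submodule ℤ (Fin n → K)} (hΓ : Γ.FG) (hn : 0 < n)
    (hμ : mu K Γ < (Module.finrank ℤ Γ : ℚ) / n) :
    ∃ (n₁ : ℕ) (W : Submodule K (Fin n → K)) (P T : (Fin n → K) →ₗ[K] (Fin n₁ → K)),
      0 < n₁ ∧ n₁ < n ∧ Function.Surjective T ∧
      (∀ u ∈ W, ∀ v, P u ⬝ᵥ T v = u ⬝ᵥ v) ∧
      mu K ((Γ ⊓ W.restrictScalars ℤ).map (P.restrictScalars ℤ)) =
        (Module.finrank ℤ ↥((Γ ⊓ W.restrictScalars ℤ).map (P.restrictScalars ℤ)) : ℚ) / n₁ ∧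
      (Module.finrank ℤ Γ : ℚ) / n <
        (Module.finrank ℤ ↥((Γ ⊓ W.restrictScalars ℤ).map (P.restrictScalars ℤ)) : ℚ) / n₁ := by
  have hE : 0 < Module.finrank K (Fin n → K) := by rwa [Module.finrank_fin_fun]
  have hμ' : mu K Γ < (Module.finrank ℤ Γ : ℚ) / Module.finrank K (Fin n → K) := by
    rwa [Module.finrank_fin_fun]
  obtain ⟨W, hW0, hlt, hmax⟩ := exists_extremal_subspace Γ hΓ hE hμ'
  rw [Module.finrank_fin_fun] at hlt
  -- `n₁ = dim W < n`
  have hn₁n : Module.finrank K W < n := by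
    rcases (Submodule.finrank_le W).lt_or_eq with h | h
    · rwa [Module.finrank_fin_fun] at h
    · exfalso
      have hWtop : W = ⊤ := Submodule.eq_top_of_finrank_eq h
      rw [hWtop, rankInter, Submodule.restrictScalars_top, inf_top_eq, finrank_top,
        Module.finrank_fin_fun] at hlt
      exact lt_irrefl _ hlt
  set n₁ := Module.finrank K W with hn₁
  -- coordinates `P` and the projection `T`
  let b : Basis (Fin n₁) K W := Module.finBasisOfFinrankEq K W rfl
  obtain ⟨g, hg⟩ := LinearMap.exists_leftInverse_of_injective W.subtype W.ker_subtype
  let P : (Fin n → K) →ₗ[K] (Fin n₁ → K) := b.equivFun.toLinearMap ∘ₗ g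
  let w : Fin n₁ → Fin n → K := fun k => ((b k : W) : Fin n → K)
  let T : (Fin n → K) →ₗ[K] (Fin n₁ → K) := (Matrix.of w).mulVecLin
  have hgu : ∀ u (hu : u ∈ W), g u = ⟨u, hu⟩ := fun u hu => LinearMap.congr_fun hg ⟨u, hu⟩
  have hPu : ∀ u (hu : u ∈ W), P u = b.equivFun ⟨u, hu⟩ := by
    intro u hu
    show b.equivFun (g u) = _
    rw [hgu u hu]
  have hw : LinearIndependent K w := b.linearIndependent.map' W.subtype W.ker_subtype
  have hT : Function.Surjective T := mulVecLin_surjective_of_linearIndependent (Matrix.of w) hw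
  have hPT : ∀ u ∈ W, ∀ v, P u ⬝ᵥ T v = u ⬝ᵥ v := by
    intro u hu v
    have hTv : T v = fun k => w k ⬝ᵥ v := funext fun k => of_mulVecLin_apply w v k
    rw [hTv, hPu u hu]
    have hsum : (∑ k, b.equivFun ⟨u, hu⟩ k • w k) = u := by
      have h := congrArg (fun z : W => (z : Fin n → K)) (b.sum_equivFun ⟨u, hu⟩)
      simp only [Submodule.coe_sum, Submodule.coe_smul] at h
      exact h
    conv_rhs => rw [← hsum]
    rw [sum_smul_dotProduct]
    rfl
  have hPinj : ∀ u ∈ W, P u = 0 → u = 0 := by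
    intro u hu h0
    rw [hPu u hu, LinearEquiv.map_eq_zero_iff] at h0
    exact congrArg Subtype.val h0
  have hPsurj : ∀ z, ∃ u ∈ W, P u = z := by
    intro z
    refine ⟨(b.equivFun.symm z : W), (b.equivFun.symm z).2, ?_⟩
    rw [hPu _ (b.equivFun.symm z).2, Subtype.coe_eta, LinearEquiv.apply_symm_apply]
  -- the subgroup `Γ₁ = P(Γ ∩ W)`
  set Γ₁ := (Γ ⊓ W.restrictScalars ℤ).map (P.restrictScalars ℤ) with hΓ₁
  have hd₁ : Module.finrank ℤ Γ₁ = rankInter K Γ W :=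
    finrank_map_eq_of_injOn P hPinj _ inf_le_right
  have hn₁pos : (0 : ℚ) < n₁ := by exact_mod_cast hW0
  have hnpos : (0 : ℚ) < n := by exact_mod_cast hn
  refine ⟨n₁, W, P, T, hW0, hn₁n, hT, hPT, ?_, ?_⟩
  · apply le_antisymm
    · have h := mu_le_rank_div (K := K) Γ₁ (by rw [Module.finrank_fin_fun]; exact hW0)
      rwa [Module.finrank_fin_fun] at h
    · have h := not_mu_map_lt_of_slope_maximal (X := Γ) hn₁.symm hW0 hmax P hPinj hPsurj
      rw [not_lt, ← hd₁] at h
      exact h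
  · rw [hd₁, div_lt_div_iff₀ hnpos hn₁pos]
    exact_mod_cast hlt

/-- **Lemme 5.2.** Let `X`, `Y` be finitely generated subgroups of `Kⁿ` (`n ≥ 1`) of ranks `d`,
`ℓ`. There are a positive integer `n' ≤ n` and finitely generated subgroups `X'`, `Y'` of `K^{n'}`,
of ranks `d'`, `ℓ'`, with `μ(X', K^{n'}) = d'/n' ≥ d/n`, `μ(Y', K^{n'}) = ℓ'/n' ≥ μ(Y, Kⁿ)` and
`⟨X', Y'⟩ ⊆ ⟨X, Y⟩` (every pairing `⟨u, v⟩`, `u ∈ X'`, `v ∈ Y'`, is a pairing `⟨u₀, v₀⟩` with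
`u₀ ∈ X`, `v₀ ∈ Y`). Proof by induction on `n` as printed: if `μ(X) < d/n`, replace `X` by the
coordinates of `X ∩ W` (`W` extremal) and `Y` by its projection; if `μ(X) = d/n` and
`μ(Y) < ℓ/n`, symmetrically; otherwise `X' = X`, `Y' = Y`.
[cite: Waldschmidt1981, §5 a) Lemme 5.2 (pp. 106–107)] -/
theorem lem_5_2 (n : ℕ) : ∀ (X Y : Submodule ℤ (Fin n → K)), X.FG → Y.FG → 0 < n →
    ∃ (n' : ℕ) (X' Y' : Submodule ℤ (Fin n' → K)), 0 < n' ∧ n' ≤ n ∧ X'.FG ∧ Y'.FG ∧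
      mu K X' = (Module.finrank ℤ X' : ℚ) / n' ∧
      (Module.finrank ℤ X : ℚ) / n ≤ (Module.finrank ℤ X' : ℚ) / n' ∧
      mu K Y' = (Module.finrank ℤ Y' : ℚ) / n' ∧ mu K Y ≤ (Module.finrank ℤ Y' : ℚ) / n' ∧
      (∀ u ∈ X', ∀ v ∈ Y', ∃ u₀ ∈ X, ∃ v₀ ∈ Y, u ⬝ᵥ v = u₀ ⬝ᵥ v₀) := by
  induction n using Nat.strong_induction_on with
  | _ n ih =>
  intro X Y hX hY hn
  have hV : 0 < Module.finrank K (Fin n → K) := by rwa [Module.finrank_fin_fun]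
  have hXle : mu K X ≤ (Module.finrank ℤ X : ℚ) / n := by
    have h := mu_le_rank_div (K := K) X hV
    rwa [Module.finrank_fin_fun] at h
  have hYle : mu K Y ≤ (Module.finrank ℤ Y : ℚ) / n := by
    have h := mu_le_rank_div (K := K) Y hV
    rwa [Module.finrank_fin_fun] at h
  by_cases hXlt : mu K X < (Module.finrank ℤ X : ℚ) / n
  · -- Premier cas: `μ(X) < d/n`
    obtain ⟨n₁, W, P, T, hn₁, hn₁n, hT, hPT, hμ₁, hlt₁⟩ := exists_step hX hn hXlt
    set X₁ := (X ⊓ W.restrictScalars ℤ).map (P.restrictScalars ℤ) with hX₁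
    set Y₁ := Y.map (T.restrictScalars ℤ) with hY₁
    haveI := finite_inf_of_fg hX (W.restrictScalars ℤ)
    have hX₁fg : X₁.FG := (Module.Finite.iff_fg.mp inferInstance : (X ⊓ W.restrictScalars ℤ).FG).map _
    have hY₁fg : Y₁.FG := hY.map _
    obtain ⟨n', X', Y', hn', hn'le, hX'fg, hY'fg, hμX', hdX', hμY', hdY', hpair⟩ :=
      ih n₁ hn₁n X₁ Y₁ hX₁fg hY₁fg hn₁
    refine ⟨n', X', Y', hn', hn'le.trans hn₁n.le, hX'fg, hY'fg, hμX', hlt₁.le.trans hdX', hμY',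
      ?_, ?_⟩
    · have hV₁ : 0 < Module.finrank K (Fin n₁ → K) := by rwa [Module.finrank_fin_fun]
      exact (mu_le_mu_map_of_surjective T hT hV₁ hY).trans hdY'
    · intro u hu v hv
      obtain ⟨u₁, hu₁, v₁, hv₁, h⟩ := hpair u hu v hv
      obtain ⟨u₀, ⟨hu₀X, hu₀W⟩, rfl⟩ := hu₁
      obtain ⟨v₀, hv₀Y, rfl⟩ := hv₁
      exact ⟨u₀, hu₀X, v₀, hv₀Y, by rw [h]; exact hPT u₀ hu₀W v₀⟩
  · have hXeq : mu K X = (Module.finrank ℤ X : ℚ) / n := le_antisymm hXle (not_lt.mp hXlt)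
    by_cases hYlt : mu K Y < (Module.finrank ℤ Y : ℚ) / n
    · -- Deuxième cas: `μ(X) = d/n`, `μ(Y) < ℓ/n`
      obtain ⟨n₂, W, P, T, hn₂, hn₂n, hT, hPT, hμ₂, hlt₂⟩ := exists_step hY hn hYlt
      set Y₂ := (Y ⊓ W.restrictScalars ℤ).map (P.restrictScalars ℤ) with hY₂
      set X₂ := X.map (T.restrictScalars ℤ) with hX₂
      haveI := finite_inf_of_fg hY (W.restrictScalars ℤ)
      have hY₂fg : Y₂.FG :=
        (Module.Finite.iff_fg.mp inferInstance : (Y ⊓ W.restrictScalars ℤ).FG).map _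
      have hX₂fg : X₂.FG := hX.map _
      obtain ⟨n', X', Y', hn', hn'le, hX'fg, hY'fg, hμX', hdX', hμY', hdY', hpair⟩ :=
        ih n₂ hn₂n X₂ Y₂ hX₂fg hY₂fg hn₂
      have hV₂ : 0 < Module.finrank K (Fin n₂ → K) := by rwa [Module.finrank_fin_fun]
      refine ⟨n', X', Y', hn', hn'le.trans hn₂n.le, hX'fg, hY'fg, hμX', ?_, hμY', ?_, ?_⟩
      · calc (Module.finrank ℤ X : ℚ) / n = mu K X := hXeq.symm
          _ ≤ mu K X₂ := mu_le_mu_map_of_surjective T hT hV₂ hX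
          _ ≤ (Module.finrank ℤ X₂ : ℚ) / n₂ := by
            have h := mu_le_rank_div (K := K) X₂ hV₂
            rwa [Module.finrank_fin_fun] at h
          _ ≤ _ := hdX'
      · calc mu K Y ≤ mu K Y₂ := by rw [hμ₂]; exact (hYlt.trans hlt₂).le
          _ ≤ _ := hdY'
      · intro u hu v hv
        obtain ⟨u₂, hu₂, v₂, hv₂, h⟩ := hpair u hu v hv
        obtain ⟨u₀, hu₀X, rfl⟩ := hu₂
        obtain ⟨v₀, ⟨hv₀Y, hv₀W⟩, rfl⟩ := hv₂
        refine ⟨u₀, hu₀X, v₀, hv₀Y, ?_⟩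
        rw [h]
        show T u₀ ⬝ᵥ P v₀ = u₀ ⬝ᵥ v₀
        rw [dotProduct_comm, hPT v₀ hv₀W u₀, dotProduct_comm]
    · -- `μ(X) = d/n` and `μ(Y) = ℓ/n`: nothing to do
      have hYeq : mu K Y = (Module.finrank ℤ Y : ℚ) / n := le_antisymm hYle (not_lt.mp hYlt)
      exact ⟨n, X, Y, hn, le_rfl, hX, hY, hXeq, le_rfl, hYeq, hYle,
        fun u hu v hv => ⟨u, hu, v, hv, rfl⟩⟩

end Lemma52

/-! ### Proposition 6.1 from Corollaire 4.2 -/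

section Prop61

open Complex

/-- **Proposition 6.1 from Corollaire 4.2** (the proof printed on p. 109). Let `X = ℤx₁ + … + ℤx_d`,
`Y = ℤy₁ + … + ℤy_ℓ` be subgroups of `ℂⁿ` of ranks `d`, `ℓ` with all `exp⟨xᵢ, yⱼ⟩` algebraic and
`d > n`, and suppose `μ(Y) > d/(d − n)`. Lemme 5.2 gives `X'`, `Y'` in `ℂ^{n'}` with
`μ(X') = d'/n' ≥ d/n`, `μ(Y') = ℓ'/n' ≥ μ(Y)` and `exp⟨X', Y'⟩ ⊂ ℚ̄`; then
`ℓ'/n' > d/(d − n) ≥ d'/(d' − n')`, so Lemme 5.3 gives `χ(Y', X') ≥ ℓ'/d' > n'/(d' − n')`,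
contradicting Corollaire 4.2 for `(X', Y')`. Hence `prop_6_1` follows from the transcendence
input `cor_4_2` alone; all the algebra of §5 is proved above.
[cite: Waldschmidt1981, §6 a) Proposition 6.1 and its proof (p. 109)] -/
theorem prop_6_1_of_cor_4_2 (h42 : cor_4_2) : prop_6_1 := by
  intro n d l x y hx hy halg hnd
  -- `n ≥ 1` (a `ℤ`-free family of positive rank does not fit in `ℂ⁰`)
  have hn : 0 < n := by
    rcases Nat.eq_zero_or_pos n with h0 | h0
    · exfalso
      subst h0
      have hd : 0 < d := lt_of_le_of_lt (Nat.zero_le _) hnd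
      exact hx.ne_zero ⟨0, hd⟩ (Subsingleton.elim _ _)
    · exact h0
  have hXfg : (span ℤ (Set.range x)).FG := Submodule.fg_span (Set.finite_range x)
  have hYfg : (span ℤ (Set.range y)).FG := Submodule.fg_span (Set.finite_range y)
  have hdX : Module.finrank ℤ (span ℤ (Set.range x)) = d := by
    rw [finrank_span_eq_card hx, Fintype.card_fin]
  by_contra hcon
  rw [not_le] at hcon
  -- Lemme 5.2
  obtain ⟨n', X', Y', hn', -, hX'fg, hY'fg, hμX', hdd', hμY', hYY', hpair⟩ :=
    lem_5_2 (K := ℂ) n (span ℤ (Set.range x)) (span ℤ (Set.range y)) hXfg hYfg hn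
  rw [hdX] at hdd'
  have hnq : (0 : ℚ) < n := by exact_mod_cast hn
  have hn'q : (0 : ℚ) < n' := by exact_mod_cast hn'
  have hndq : (n : ℚ) < d := by exact_mod_cast hnd
  -- `d' > n'`
  have h1 : (n' : ℚ) < Module.finrank ℤ X' := by
    have h0 : (1 : ℚ) < (d : ℚ) / n := by rw [lt_div_iff₀ hnq]; linarith
    have h2 : (1 : ℚ) < (Module.finrank ℤ X' : ℚ) / n' := h0.trans_le hdd'
    rwa [lt_div_iff₀ hn'q, one_mul] at h2
  have hn'd' : n' < Module.finrank ℤ X' := by exact_mod_cast h1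
  -- `ℓ'/n' > d/(d − n) ≥ d'/(d' − n')`
  have hdn : (0 : ℚ) < d - n := by linarith
  have hd'n' : (0 : ℚ) < (Module.finrank ℤ X' : ℚ) - n' := by linarith
  have h3 : (Module.finrank ℤ X' : ℚ) / ((Module.finrank ℤ X' : ℚ) - n') ≤ (d : ℚ) / (d - n) := by
    rw [div_le_div_iff₀ hd'n' hdn]
    have h4 := hdd'
    rw [div_le_div_iff₀ hnq hn'q] at h4
    nlinarith
  have h5 : (Module.finrank ℤ X' : ℚ) / ((Module.finrank ℤ X' : ℚ) - n') <
      (Module.finrank ℤ Y' : ℚ) / n' := lt_of_le_of_lt h3 (hcon.trans_le hYY')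
  -- bases of `X'`, `Y'`; Corollaire 4.2 for `(X', Y')`
  obtain ⟨x', hx', hx'X, hx'span⟩ := exists_linearIndependent_span_eq hX'fg
  obtain ⟨y', hy', hy'Y, hy'span⟩ := exists_linearIndependent_span_eq hY'fg
  have halg' : ∀ i j, IsAlgebraic ℚ (cexp (x' i ⬝ᵥ y' j)) := by
    intro i j
    obtain ⟨u₀, hu₀, v₀, hv₀, h⟩ := hpair (x' i) (hx'X i) (y' j) (hy'Y j)
    rw [h]
    exact isAlgebraic_cexp_dotProduct_of_mem_span halg hu₀ hv₀
  have h42' := h42 x' y' hx' hy' halg' hn'd'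
  rw [hx'span, hy'span] at h42'
  -- Lemme 5.3 for `(X', Y')`
  have h53 := lem_5_3 hX'fg hY'fg hμX' h1 (by rw [hμY']; exact h5.le)
  rw [hμY'] at h53
  have h7 := h53.trans h42'
  -- the contradiction
  have hd'q : (0 : ℚ) < Module.finrank ℤ X' := by linarith
  set d' : ℚ := (Module.finrank ℤ X' : ℚ) with hd'
  set l' : ℚ := (Module.finrank ℤ Y' : ℚ) with hl'
  set m' : ℚ := (n' : ℚ) with hm'
  have h6 : m' / d' * (l' / m') = l' / d' := by field_simp
  rw [h6, div_le_div_iff₀ hd'q hd'n'] at h7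
  rw [div_lt_div_iff₀ hd'n' hn'q] at h5
  linarith

end Prop61

end Literature.NumberTheory.Transcendental.Waldschmidt1981

end
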